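import Summits.ABC.IUTFork.Cor312RamifiedPlaceData
import Literature.IUT.LogVolume.FakeAdeleIndex
import Literature.RingTheory.DiscreteValuationRing.AdicCompletionResidueField
import HarnessLib

/-!
# [IUTchIII] Cor. 3.12, Team R ramified-mover thread — the place `v ∣ 3` of `K₃ = ℚ(ζ₃)`:
# `v = (ζ₃ − 1)`, `λ` is a uniformizer of `K_v`, and the residue field of `K_v` is `𝔽₃`

Proof-only file (theorems, no definitions) of the abc-iut cell (seat abc-iut-w4-d062, gen 4; input for
GAP-LEDGER row G-c312-14-1 of Team R lead abc-iut-c312-14), over abc-iut-c312-14's data file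
`Cor312RamifiedPlaceData` (`K3 = CyclotomicField 3 ℚ`, `zeta3`, `lam = ζ₃ − 1`, `lam_sq : λ² = −3ζ₃`).
Everything here is classical algebraic number theory of the third cyclotomic field; it TAKES NO SIDE on
[IUTchIII] Cor. 3.12 and asserts no IUT statement. For ANY finite place `v` of `K₃` with `3 ∈ v`
(there is exactly one):

* `residueChar_eq_three`, `asIdeal_eq_span_lam` — `p_v = 3` and `v = (ζ₃ − 1)` (Mathlib
  `IsCyclotomicExtension.Rat.eq_span_zeta_sub_one_of_liesOver'`);
* `valued_lam`, `valued_le_valued_lam_of_lt_one` — in the completion `K_v`, `v(λ) = exp(−1)` (Mathlib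
  `intValuation_singleton`), hence DISCRETENESS `v(x) < 1 ⇒ v(x) ≤ v(λ)`;
* `exists_int_sub_mem_span_lam`, `exists_nat_lt_three_sub_mem` — every algebraic integer of `K₃` is
  `≡ 0, 1, 2 (mod λ)` (`𝓞 K₃ = ℤ[ζ₃]` via Mathlib's `integralPowerBasis`, `ζ₃ ≡ 1 (mod λ)`);
* `exists_nat_lt_three_valued_sub_lt_one` — the RESIDUE FIELD OF `K_v` IS `𝔽₃`: every `y ∈ 𝒪_v` has
  `v(y − n) < 1` for some `n ∈ {0, 1, 2}` (density of `𝓞 K₃` in `𝒪_v`: the tree's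
  `IsDedekindDomain.HeightOneSpectrum.exists_sub_algebraMap_mem_maximalIdeal`).

Consumer: `Cor312RamifiedShellBall.lean` (the analytic log-shell at `v` is the ball `𝒪_v`).
References: Neukirch, *Algebraic Number Theory*, Ch. I (10.1) (`(3) = (1 − ζ₃)²` in `ℤ[ζ₃]`), Ch. II §4.
[folklore] throughout; standard axioms only.
-/

noncomputable section

namespace Summit.ABC.IUTFork.RamifiedMover.ShellBall

open IsDedekindDomain IsDedekindDomain.HeightOneSpectrum NumberField
open Literature.IUT.LogVolume

/-! ## 1. The place `v ∣ 3` of `K₃ = ℚ(ζ₃)`: `v = (λ)`, residue characteristic `3`, `v(λ) = 1` -/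

/-- The residue characteristic of a place of `K₃` containing `3` is `3`. [folklore] -/
theorem residueChar_eq_three (v : HeightOneSpectrum (𝓞 K3)) (hv : ((3 : ℕ) : 𝓞 K3) ∈ v.asIdeal) :
    residueChar K3 v = 3 := by
  have h1 : ((3 : ℕ) : ℤ) ∈ v.asIdeal.under ℤ := by
    rw [Ideal.mem_comap]; simpa using hv
  have h3 : v.asIdeal.under ℤ = Ideal.span {(Ideal.absNorm (v.asIdeal.under ℤ) : ℤ)} :=
    (Int.liesOver_span_absNorm v.asIdeal).over.symm
  rw [h3, Ideal.mem_span_singleton, Int.natCast_dvd_natCast] at h1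
  exact (Nat.prime_dvd_prime_iff_eq (residueChar_prime K3 v) Nat.prime_three).mp h1

/-- A place of `K₃` containing `3` lies over `(3) ⊆ ℤ`. [folklore] -/
theorem liesOver_three (v : HeightOneSpectrum (𝓞 K3)) (hv : ((3 : ℕ) : 𝓞 K3) ∈ v.asIdeal) :
    v.asIdeal.LiesOver (Ideal.span {((3 : ℕ) : ℤ)}) := by
  have h := liesOver_residueChar K3 v
  rwa [residueChar_eq_three v hv] at h

/-- **`v = (ζ₃ − 1)`**: the unique prime of `𝓞 K₃ = ℤ[ζ₃]` above `3` (Mathlib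
`IsCyclotomicExtension.Rat.eq_span_zeta_sub_one_of_liesOver'`). [folklore] -/
theorem asIdeal_eq_span_lam (v : HeightOneSpectrum (𝓞 K3)) (hv : ((3 : ℕ) : 𝓞 K3) ∈ v.asIdeal) :
    v.asIdeal = Ideal.span {zeta3_spec.toInteger - 1} := by
  haveI := cycInst
  haveI : Fact (Nat.Prime 3) := ⟨Nat.prime_three⟩
  haveI := liesOver_three v hv
  haveI : v.asIdeal.IsPrime := v.isPrime
  exact IsCyclotomicExtension.Rat.eq_span_zeta_sub_one_of_liesOver' 3 K3 zeta3_spec v.asIdeal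

/-- `λ = ζ₃ − 1` is a uniformizer at `v`: `v(λ) = exp(−1)` in the completion `K_v`. [folklore] -/
theorem valued_lam (v : HeightOneSpectrum (𝓞 K3)) (hv : ((3 : ℕ) : 𝓞 K3) ∈ v.asIdeal) :
    Valued.v ((lam : K3) : v.adicCompletion K3) = WithZero.exp (-1 : ℤ) := by
  have hne : (zeta3_spec.toInteger - 1 : 𝓞 K3) ≠ 0 := by
    intro h
    apply zeta3_ne_one
    have := congrArg (fun x : 𝓞 K3 => (x : K3)) h
    simpa [sub_eq_zero] using this
  have hlam : (lam : K3) = algebraMap (𝓞 K3) K3 (zeta3_spec.toInteger - 1) := by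
    simp [lam]
  rw [hlam, valuedAdicCompletion_eq_valuation' v, valuation_of_algebraMap,
    intValuation_singleton v hne (asIdeal_eq_span_lam v hv)]

/-- Discreteness: in `K_v`, `v(x) < 1 ⇒ v(x) ≤ v(λ)`. [folklore] -/
theorem valued_le_valued_lam_of_lt_one (v : HeightOneSpectrum (𝓞 K3))
    (hv : ((3 : ℕ) : 𝓞 K3) ∈ v.asIdeal) {x : v.adicCompletion K3} (hx : Valued.v x < 1) :
    Valued.v x ≤ Valued.v ((lam : K3) : v.adicCompletion K3) := by
  rw [valued_lam v hv]
  by_cases h0 : Valued.v x = 0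
  · rw [h0]; exact zero_le
  · obtain ⟨k, hk⟩ : ∃ k : ℤ, Valued.v x = WithZero.exp k :=
      ⟨WithZero.log (Valued.v x), (WithZero.exp_log h0).symm⟩
    rw [hk] at hx ⊢
    rw [← WithZero.exp_zero, WithZero.exp_lt_exp] at hx
    rw [WithZero.exp_le_exp]
    omega


/-! ## 2. The residue field at `v` is `𝔽₃`: every `v`-integer is `≡ 0, 1` or `2 (mod 𝔪_v)` -/

/-- Every algebraic integer of `K₃` is congruent to a rational integer modulo `λ`
(`𝓞 K₃ = ℤ[ζ₃]`, `ζ₃ ≡ 1 (mod λ)`). [folklore] -/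
theorem exists_int_sub_mem_span_lam (c : 𝓞 K3) :
    ∃ m : ℤ, c - m ∈ Ideal.span ({zeta3_spec.toInteger - 1} : Set (𝓞 K3)) := by
  haveI := cycInst
  set I : Ideal (𝓞 K3) := Ideal.span ({zeta3_spec.toInteger - 1} : Set (𝓞 K3)) with hI
  have htop : Algebra.adjoin ℤ ({zeta3_spec.toInteger} : Set (𝓞 K3)) = ⊤ := by
    rw [← IsPrimitiveRoot.integralPowerBasis_gen (K := K3) zeta3_spec]
    exact zeta3_spec.integralPowerBasis.adjoin_gen_eq_top
  have hc : c ∈ Algebra.adjoin ℤ ({zeta3_spec.toInteger} : Set (𝓞 K3)) := by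
    rw [htop]; exact Algebra.mem_top
  refine Algebra.adjoin_induction (p := fun (x : 𝓞 K3) _ => ∃ m : ℤ, x - (m : 𝓞 K3) ∈ I) ?_ ?_ ?_ ?_ hc
  · intro x hx
    rw [Set.mem_singleton_iff] at hx
    subst hx
    exact ⟨1, by rw [Int.cast_one]; exact Ideal.subset_span rfl⟩
  · intro r
    exact ⟨r, by simp⟩
  · rintro x y - - ⟨m, hm⟩ ⟨n, hn⟩
    refine ⟨m + n, ?_⟩
    have : x + y - ((m + n : ℤ) : 𝓞 K3) = (x - m) + (y - n) := by push_cast; ring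
    rw [this]
    exact I.add_mem hm hn
  · rintro x y - - ⟨m, hm⟩ ⟨n, hn⟩
    refine ⟨m * n, ?_⟩
    have : x * y - ((m * n : ℤ) : 𝓞 K3) = x * (y - n) + (x - m) * n := by push_cast; ring
    rw [this]
    exact I.add_mem (I.mul_mem_left _ hn) (I.mul_mem_right _ hm)

/-- Every algebraic integer of `K₃` is congruent to `0`, `1` or `2` modulo a place `v ∋ 3`.
[folklore] -/
theorem exists_nat_lt_three_sub_mem (v : HeightOneSpectrum (𝓞 K3))
    (hv : ((3 : ℕ) : 𝓞 K3) ∈ v.asIdeal) (c : 𝓞 K3) :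
    ∃ n : ℕ, n < 3 ∧ c - (n : 𝓞 K3) ∈ v.asIdeal := by
  obtain ⟨m, hm⟩ := exists_int_sub_mem_span_lam c
  rw [← asIdeal_eq_span_lam v hv] at hm
  refine ⟨(m % 3).toNat, ?_, ?_⟩
  · have h1 : m % 3 < 3 := Int.emod_lt_of_pos m (by norm_num)
    have h0 : 0 ≤ m % 3 := Int.emod_nonneg m (by norm_num)
    omega
  · have h0 : 0 ≤ m % 3 := Int.emod_nonneg m (by norm_num)
    have hcast : (((m % 3).toNat : ℕ) : 𝓞 K3) = ((m % 3 : ℤ) : 𝓞 K3) := by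
      rw [← Int.cast_natCast, Int.toNat_of_nonneg h0]
    have hdecomp : c - (((m % 3).toNat : ℕ) : 𝓞 K3) =
        (c - m) + ((m / 3 : ℤ) : 𝓞 K3) * ((3 : ℕ) : 𝓞 K3) := by
      rw [hcast]
      have hdiv' : (3 * (m / 3) + m % 3 : ℤ) = m := by omega
      have hdiv : ((3 * (m / 3) + m % 3 : ℤ) : 𝓞 K3) = (m : 𝓞 K3) := by rw [hdiv']
      push_cast at hdiv ⊢
      linear_combination -hdiv
    rw [hdecomp]
    exact v.asIdeal.add_mem hm (v.asIdeal.mul_mem_left _ hv)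

/-- **The residue field of `K_v` is `𝔽₃`**: every `v`-integer `y ∈ 𝒪_v` satisfies
`v(y − n) < 1` for some `n ∈ {0, 1, 2}` (density of `𝓞 K₃` in `𝒪_v` + §2). [folklore] -/
theorem exists_nat_lt_three_valued_sub_lt_one (v : HeightOneSpectrum (𝓞 K3))
    (hv : ((3 : ℕ) : 𝓞 K3) ∈ v.asIdeal) {y : v.adicCompletion K3} (hy : Valued.v y ≤ 1) :
    ∃ n : ℕ, n < 3 ∧ Valued.v (y - n) < 1 := by
  have hy' : y ∈ v.adicCompletionIntegers K3 := (mem_adicCompletionIntegers (𝓞 K3) K3 v).mpr hy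
  obtain ⟨c, hc⟩ := exists_sub_algebraMap_mem_maximalIdeal K3 v ⟨y, hy'⟩
  obtain ⟨n, hn3, hn⟩ := exists_nat_lt_three_sub_mem v hv c
  refine ⟨n, hn3, ?_⟩
  set t : v.adicCompletion K3 := ((algebraMap (𝓞 K3) K3 c : K3) : v.adicCompletion K3) with ht
  -- `v(y - c) < 1`
  have hne : Valued.v (y - t) ≠ 1 := by
    rw [IsLocalRing.mem_maximalIdeal, mem_nonunits_iff,
      adicCompletionIntegers.isUnit_iff_valued_eq_one] at hc
    have hcoe : ((⟨y, hy'⟩ - algebraMap (𝓞 K3) (v.adicCompletionIntegers K3) c :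
        v.adicCompletionIntegers K3) : v.adicCompletion K3) = y - t := by
      rw [AddSubgroupClass.coe_sub, algebraMap_adicCompletionIntegers_apply (𝓞 K3) K3 v c]
    rwa [hcoe] at hc
  have hle : Valued.v (y - t) ≤ 1 := by
    refine (Valuation.map_sub _ _ _).trans (max_le hy ?_)
    rw [ht, valuedAdicCompletion_eq_valuation' v]
    exact valuation_le_one v c
  have hyc : Valued.v (y - t) < 1 := lt_of_le_of_ne hle hne
  -- `v(c - n) < 1`
  have hcn : Valued.v (t - n) < 1 := by
    have h := (intValuation_lt_one_iff_mem v (c - (n : 𝓞 K3))).mpr hn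
    rw [← valuation_of_algebraMap (K := K3), ← valuedAdicCompletion_eq_valuation' v] at h
    have e1 : t - (n : v.adicCompletion K3) =
        (((algebraMap (𝓞 K3) K3 (c - (n : 𝓞 K3))) : K3) : v.adicCompletion K3) := by
      rw [ht]
      change algebraMap K3 (v.adicCompletion K3) (algebraMap (𝓞 K3) K3 c) - n =
        algebraMap K3 (v.adicCompletion K3) (algebraMap (𝓞 K3) K3 (c - (n : 𝓞 K3)))
      rw [map_sub, map_natCast, map_sub, map_natCast]
    rwa [e1]
  have h := Valuation.map_add_lt Valued.v hyc hcn
  rwa [sub_add_sub_cancel] at h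

end Summit.ABC.IUTFork.RamifiedMover.ShellBall

end
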